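/-
Copyright (c) 2026 the pub-hodgecm-mathlib formalisation cell (harness21).  Prover seat hodgecm-mathlib-K2Liu-p10 (g2), Track B «K2-LIT»,
#184♮ = hLiu418 = `stmt-HodgeConjecture-24832`; LEAD F0P6-plan (g13) RULING «M-157a» (1): G5-a sub-organ (α) (the middle cell of the constant term),
file α1 — TRANSPORT OF COVERING WEIGHTS AND WEIGHTED INTEGRALS UNDER A MEASURE-PRESERVING GROUP AUTOMORPHISM.  THEOREMS ONLY (no `def`, no
`instance`, no named-fact hypothesis, no `sorry`).
-/
import Literature.MeasureTheory.Group.CoveringWeightsBochner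
import HarnessLib

/-!
# Crux `HLiu418`, ROAD Φ, (α) file α1: COVERING WEIGHTS AND WEIGHTED INTEGRALS UNDER A GROUP AUTOMORPHISM

Cell `hodgecm-mathlib`, crux item hLiu418 = `stmt-HodgeConjecture-24832` (helper lane, count-neutral).  In the quotient-free currency of
★ `Literature.MeasureTheory.Group.CoveringWeights{,Bochner}` ("`∫_{Γ∖X} F`" is `∫_X β • F` for a `Γ`-covering weight `β`), the middle cell of
the constant term of the Siegel Eisenstein series (★ `K2LiuConstantTermDelta.constTerm_three_cells`, sum over the `N_Δ(L⁺)`-orbits of the middle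
cosets `[w₁ Λ(γ)]`, `γ ∈ B(L)∖GL₂(L)`) must be TRANSPORTED along the conjugations `u ↦ Λ(γ) u Λ(γ)⁻¹` of `N_Δ(𝔸)`: the orbit of `[w₁ Λ(γ)]` has
stabiliser `Λ(γ)⁻¹ N_χ(L⁺) Λ(γ)` and `f(w₁ Λ(γ) u h) = f(w₁ (Λ(γ)uΛ(γ)⁻¹) Λ(γ) h)`.  This file is the abstract device, for a group `G` with a
left-invariant measure `ν`, a measurable group automorphism `φ : G ≃* G` PRESERVING `ν`, and a countable subgroup `Γ ≤ G`:
* `coveringSum_comp_symm` — `Σ_{γ∈Γ} β(φ⁻¹(γ y)) = Σ_{γ'∈φ⁻¹Γ} β(γ' φ⁻¹y)`; `isCoveringWeight_comp` ∕ `isCoveringWeight_comp_symm` — pull-backs of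
  covering weights along `φ` (`φ⁻¹Γ`-weights ↔ `Γ`-weights);
* **`integral_wt_smul_comp_mulEquiv`** — for a left-`Γ`-invariant strongly measurable `Φ` with `∫ ‖Φ‖ β₂ dν < ∞`, a `Γ`-covering weight `β₂` and a
  `φ⁻¹Γ`-covering weight `β₁`: **`∫ β₁(x) • Φ(φ x) dν(x) = ∫ β₂(x) • Φ(x) dν(x)`** (change of variables + independence of the weight,
  ★ `integral_wt_smul_eq_of_coveringSum_eq_one`); `lintegral_mul_comp_mulEquiv` — its Tonelli twin for the `L¹` bounds.
Sources: [MoeglinWaldspurger1995, II.1.7 (the unfolding of the constant term along `w⁻¹Pw ∩ N`)]; Bourbaki, *Intégration* VII §2 no. 3–4;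
[CogdellAnalyticTheory2004, §2.3].
HONEST LABEL.  Helper lemmas, count-neutral; `HC_CM` is proved only modulo the 7 printed citations (2 remaining named inputs:
hLiu418 = `stmt-HodgeConjecture-24832`, h413 = `stmt-HodgeConjecture-24833`) until rung 0 closes.
-/

set_option autoImplicit false
set_option linter.dupNamespace false -- the mandated namespace repeats `HodgeConjecture.HodgeConjecture`

noncomputable section

namespace Summit.HodgeConjecture.HodgeConjecture.Cruxes.HLiu418.K2LiuCoveringWeightTransport

open scoped ENNReal NNReal
open MeasureTheory MeasureTheory.Measure Set Function
open Literature.MeasureTheory.Group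

variable {G : Type*} [Group G]

/-! ## 1. Covering sums and covering weights under a group automorphism -/

/-- The subgroup `φ⁻¹Γ = Γ.comap φ` is in bijection with `Γ` along `φ`. [folklore] -/
theorem exists_equiv_comap (φ : G ≃* G) (Γ : Subgroup G) :
    ∃ ε : Γ.comap φ.toMonoidHom ≃ Γ, ∀ γ' : Γ.comap φ.toMonoidHom, ((ε γ' : Γ) : G) = φ (γ' : G) := by
  have hmem : ∀ γ : Γ, φ.symm (γ : G) ∈ Γ.comap φ.toMonoidHom := fun γ => by
    rw [Subgroup.mem_comap, MulEquiv.coe_toMonoidHom, MulEquiv.apply_symm_apply]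
    exact γ.2
  exact ⟨{ toFun := fun γ' => ⟨φ (γ' : G), γ'.2⟩,
           invFun := fun γ => ⟨φ.symm (γ : G), hmem γ⟩,
           left_inv := fun γ' => Subtype.ext (φ.symm_apply_apply _),
           right_inv := fun γ => Subtype.ext (φ.apply_symm_apply _) }, fun γ' => rfl⟩

/-- **Covering sums along `φ⁻¹`**: `Σ_{γ ∈ Γ} β(φ⁻¹(γ • y)) = Σ_{γ' ∈ φ⁻¹Γ} β(γ' • φ⁻¹ y)`. [folklore] -/
theorem coveringSum_comp_symm (φ : G ≃* G) (Γ : Subgroup G) (β : G → ℝ≥0∞) (y : G) :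
    coveringSum Γ (fun x => β (φ.symm x)) y = coveringSum (Γ.comap φ.toMonoidHom) β (φ.symm y) := by
  obtain ⟨ε, hε⟩ := exists_equiv_comap φ Γ
  rw [coveringSum_apply, coveringSum_apply, ← ε.tsum_eq]
  refine tsum_congr fun γ' => ?_
  rw [Subgroup.smul_def, Subgroup.smul_def, smul_eq_mul, smul_eq_mul, map_mul, hε, MulEquiv.symm_apply_apply]

/-- **Covering sums along `φ`**: `Σ_{γ' ∈ φ⁻¹Γ} β(φ(γ' • x)) = Σ_{γ ∈ Γ} β(γ • φ x)`. [folklore] -/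
theorem coveringSum_comp (φ : G ≃* G) (Γ : Subgroup G) (β : G → ℝ≥0∞) (x : G) :
    coveringSum (Γ.comap φ.toMonoidHom) (fun x => β (φ x)) x = coveringSum Γ β (φ x) := by
  obtain ⟨ε, hε⟩ := exists_equiv_comap φ Γ
  rw [coveringSum_apply, coveringSum_apply, ← ε.tsum_eq]
  refine tsum_congr fun γ' => ?_
  rw [Subgroup.smul_def, Subgroup.smul_def, smul_eq_mul, smul_eq_mul, map_mul, hε]

variable [MeasurableSpace G]

/-- A `φ⁻¹Γ`-covering weight pushed along `φ` (`β ∘ φ⁻¹`) is a `Γ`-covering weight. [folklore] -/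
theorem isCoveringWeight_comp_symm (φ : G ≃* G) (hφs : Measurable φ.symm) (Γ : Subgroup G) {β : G → ℝ≥0∞}
    (hβ : IsCoveringWeight (Γ.comap φ.toMonoidHom) β) : IsCoveringWeight Γ (fun x => β (φ.symm x)) :=
  ⟨hβ.1.comp hφs, fun y => by rw [coveringSum_comp_symm, hβ.2]⟩

/-- A `Γ`-covering weight pulled back along `φ` (`β ∘ φ`) is a `φ⁻¹Γ`-covering weight. [folklore] -/
theorem isCoveringWeight_comp (φ : G ≃* G) (hφ : Measurable φ) (Γ : Subgroup G) {β : G → ℝ≥0∞}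
    (hβ : IsCoveringWeight Γ β) : IsCoveringWeight (Γ.comap φ.toMonoidHom) (fun x => β (φ x)) :=
  ⟨hβ.1.comp hφ, fun x => by rw [coveringSum_comp, hβ.2]⟩

/-! ## 2. Weighted integrals under a measure-preserving group automorphism -/

variable [MeasurableMul G] (ν : Measure G) [ν.IsMulLeftInvariant]
  {E : Type*} [NormedAddCommGroup E] [NormedSpace ℝ E]

/-- **TRANSPORT OF WEIGHTED INTEGRALS.**  `φ : G ≃* G` measurable (with measurable inverse) and `ν`-preserving, `Γ ≤ G` countable, `Φ` strongly
measurable and left-`Γ`-invariant with `∫ ‖Φ‖ β₂ dν < ∞` for a `Γ`-covering weight `β₂`; then for every `φ⁻¹Γ`-covering weight `β₁`: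
`∫ β₁(x) • Φ(φ x) dν(x) = ∫ β₂(x) • Φ(x) dν(x)` — both compute "`∫_{Γ∖G} Φ`".
[cite: MoeglinWaldspurger1995, II.1.7] [cite: CogdellAnalyticTheory2004, §2.3] -/
theorem integral_wt_smul_comp_mulEquiv (φ : G ≃* G) (hφ : Measurable φ) (hφs : Measurable φ.symm) (hmp : MeasurePreserving φ ν ν)
    (Γ : Subgroup G) [Countable Γ] {β₁ β₂ : G → ℝ≥0∞} (hβ₂ : IsCoveringWeight Γ β₂) (hβ₁ : IsCoveringWeight (Γ.comap φ.toMonoidHom) β₁)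
    {Φ : G → E} (hΦm : StronglyMeasurable Φ) (hΦinv : ∀ γ ∈ Γ, ∀ x, Φ (γ * x) = Φ x) (hint : ∫⁻ x, ‖Φ x‖ₑ * β₂ x ∂ν ≠ ∞) :
    ∫ x, (β₁ x).toReal • Φ (φ x) ∂ν = ∫ x, (β₂ x).toReal • Φ x ∂ν := by
  haveI : MeasurableConstSMul G G := ⟨fun g => measurable_const_mul g⟩
  haveI : SMulInvariantMeasure G G ν :=
    ⟨fun g s _hs => by rw [show (fun x : G => g • x) ⁻¹' s = (fun x => g * x) ⁻¹' s from rfl, measure_preimage_mul]⟩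
  -- the measurable equivalence underlying `φ`
  set eφ : G ≃ᵐ G := { toEquiv := φ.toEquiv, measurable_toFun := hφ, measurable_invFun := hφs } with heφ
  have heφ_apply : ∀ x, eφ x = φ x := fun _ => rfl
  have hmp' : MeasurePreserving eφ ν ν := hmp
  -- change of variables
  have h1 : ∫ x, (β₁ x).toReal • Φ (φ x) ∂ν = ∫ y, (β₁ (φ.symm y)).toReal • Φ y ∂ν := by
    have h := hmp'.integral_comp' (fun y => (β₁ (φ.symm y)).toReal • Φ y)
    simp only [heφ_apply, MulEquiv.symm_apply_apply] at h
    exact h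
  rw [h1]
  -- independence of the weight
  have hβ₁' := isCoveringWeight_comp_symm φ hφs Γ hβ₁
  have hΦinv' : ∀ (γ : Γ) (x : G), Φ (γ • x) = Φ x := fun γ x => by
    rw [Subgroup.smul_def, smul_eq_mul]
    exact hΦinv γ γ.2 x
  exact (integral_wt_smul_eq_of_coveringSum_eq_one ν hΦm hΦinv' hβ₂.1 hβ₁'.1 hβ₂.2 hβ₁'.2 hint.lt_top).symm

/-- **Tonelli twin**: `∫⁻ F(φ x) β₁(x) dν = ∫⁻ F(x) β₂(x) dν` for a left-`Γ`-invariant measurable `F ≥ 0` (no finiteness needed) — transports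
the `L¹` bounds. [cite: MoeglinWaldspurger1995, II.1.7] -/
theorem lintegral_mul_comp_mulEquiv (φ : G ≃* G) (hφ : Measurable φ) (hφs : Measurable φ.symm) (hmp : MeasurePreserving φ ν ν)
    (Γ : Subgroup G) [Countable Γ] {β₁ β₂ : G → ℝ≥0∞} (hβ₂ : IsCoveringWeight Γ β₂) (hβ₁ : IsCoveringWeight (Γ.comap φ.toMonoidHom) β₁)
    {F : G → ℝ≥0∞} (hFm : Measurable F) (hFinv : ∀ γ ∈ Γ, ∀ x, F (γ * x) = F x) :
    ∫⁻ x, F (φ x) * β₁ x ∂ν = ∫⁻ x, F x * β₂ x ∂ν := by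
  haveI : MeasurableConstSMul G G := ⟨fun g => measurable_const_mul g⟩
  haveI : SMulInvariantMeasure G G ν :=
    ⟨fun g s _hs => by rw [show (fun x : G => g • x) ⁻¹' s = (fun x => g * x) ⁻¹' s from rfl, measure_preimage_mul]⟩
  set eφ : G ≃ᵐ G := { toEquiv := φ.toEquiv, measurable_toFun := hφ, measurable_invFun := hφs } with heφ
  have heφ_apply : ∀ x, eφ x = φ x := fun _ => rfl
  have hmp' : MeasurePreserving eφ ν ν := hmp
  have h1 : ∫⁻ x, F (φ x) * β₁ x ∂ν = ∫⁻ y, F y * β₁ (φ.symm y) ∂ν := by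
    have h := hmp'.lintegral_comp_emb eφ.measurableEmbedding (fun y => F y * β₁ (φ.symm y))
    simp only [heφ_apply, MulEquiv.symm_apply_apply] at h
    exact h
  rw [h1]
  have hβ₁' := isCoveringWeight_comp_symm φ hφs Γ hβ₁
  have hFinv' : ∀ (γ : Γ) (x : G), F (γ • x) = F x := fun γ x => by
    rw [Subgroup.smul_def, smul_eq_mul]
    exact hFinv γ γ.2 x
  exact lintegral_mul_eq_of_coveringSum_eq ν hFm hFinv' hβ₁'.1 hβ₂.1 one_ne_zero ENNReal.one_ne_top hβ₁'.2 hβ₂.2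

/-- **Corollary (the shape used by the middle cell).**  With `Φ x := F (x * h)` for a function `F` on `G` and a parameter `h`:
`∫ β₁(x) • F(φ(x) h) dν = ∫ β₂(x) • F(x h) dν`. [cite: MoeglinWaldspurger1995, II.1.7] -/
theorem integral_wt_smul_comp_mulEquiv_mul (φ : G ≃* G) (hφ : Measurable φ) (hφs : Measurable φ.symm) (hmp : MeasurePreserving φ ν ν)
    (Γ : Subgroup G) [Countable Γ] {β₁ β₂ : G → ℝ≥0∞} (hβ₂ : IsCoveringWeight Γ β₂) (hβ₁ : IsCoveringWeight (Γ.comap φ.toMonoidHom) β₁)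
    {F : G → E} (h : G) (hFm : StronglyMeasurable fun x => F (x * h)) (hFinv : ∀ γ ∈ Γ, ∀ x, F (γ * x * h) = F (x * h))
    (hint : ∫⁻ x, ‖F (x * h)‖ₑ * β₂ x ∂ν ≠ ∞) :
    ∫ x, (β₁ x).toReal • F (φ x * h) ∂ν = ∫ x, (β₂ x).toReal • F (x * h) ∂ν :=
  integral_wt_smul_comp_mulEquiv ν φ hφ hφs hmp Γ hβ₂ hβ₁ (Φ := fun x => F (x * h)) hFm
    (fun γ hγ x => by simpa only [mul_assoc] using hFinv γ hγ x) hint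

end Summit.HodgeConjecture.HodgeConjecture.Cruxes.HLiu418.K2LiuCoveringWeightTransport

end
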